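import Summits.QuantumFields.YangMills.Theorems.FluctuationComparisonRegPrIntLS2BetaCurlBudgetBkgRegRep
import HarnessLib

/-!
# S2β · (SCT″-c)₁ — «THE c₁ LETTER OVER (BKG) + THM-2 LETTERS»: ✓p841503 `c1Budget_bkgRegRep`'s transported-size binder `(mT) (hmT) (hMT : Λ̄·L^k·‖X 0‖ ≤ mT)`
# DISCHARGED from the fine size letter it already displays (`hX0 : ‖X 0 b‖ ≤ cX·(L⁻¹)^{K−J}`): `mT := Λ̄·cX` (`pi_norm_le_iff_of_nonneg` + `Submodule.norm_coe` +
# `L^k·(L⁻¹)^{K−J} ≤ 1` for `k < K−J`).  The c₁ letter `c1Budget_thm2Letters` displays ONLY: (T) `Mg hMg hMg4`, `Mbar hM0 hM1 hM` (✓p836413 station prefix) · (BKG)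
# `hBKG` + windows `h24 hSU hρα hρδ hwinK ha16` · the THM-2 letters at the representative — `r hr0 hr Cr hCr hrp` (one-step second-order remainders + profile),
# `c₀ hc₀nn hc₀ Cc hCc hcc` (`L^k`-word oscillation + profile), `cX hcX hX0` (fine size) · `c hc0 hc4 hζc` (✓p841305 (γ) at the smooth-moved triple) · radii
# `ρr hρ0 hρr`, `a₀ ha0 ha` · `Cst hCst`, `REL`, `S′`.

Cell `ym3-torus` (YM ladder rung R3 = continuum `SU(2)` Yang–Mills on the three-torus at fixed lattice data — a RUNG: NOT d = 4, NOT infinite volume, NOT a mass gap,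
NOT Clay).  Width seat `ym-ust-20520-w4` (gen 29); crux `stmt-QuantumFields-20520`, LINE g18-1 S2β; piece (g5) (OFFER 05:39:07Z).  `--kind proof --supports
stmt-QuantumFields-20520 --as helper`, count-neutral, DEFINITION-FREE (0 `def`, 0 `instance`, 0 `notation`, 0 `sorry`, default heartbeats).

WHAT IS PROVED (sorry-free).  ★★★`c1Budget_thm2Letters` = ✓p841503 with `(Cr Cc mT) (hCr hCc hmT) … (hMT)` REPLACED by `(Cr Cc) (hCr hCc) …` and `mT := Λ̄·cX` substituted
in PROFILED's level-free `o`; proof: `‖X 0‖ ≤ cX·η` from `hX0`, then `Λ̄·L^k·‖X 0‖ ≤ Λ̄·cX·(L^k·η) ≤ Λ̄·cX`, then `exact c1Budget_bkgRegRep …`.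
[Balaban1985Averaging] (19)–(20) p.21, Prop. 3 (121)–(125) p.36, Prop. 4 (128)–(135) pp.37–38; [Balaban1985RegularSpaces] Thm 2 (1.36) p.82; [Balaban1987RG1] (0.11),
(0.18) pp.253–255.

HONEST SCOPE.  Composition by name + one norm estimate; nothing of Bałaban's renormalisation-group analysis is asserted or proved; every displayed letter∕window is a
HYPOTHESIS or others'; GAP♯∘ (`stub_uniformFibreGapOrbit`, registry 3732b7df UNTOUCHED, 0∕5), S2β, the five registered stubs, crux 20520, 19936, 19200 and
`YM3TorusSU2` are NOT proved; no registered stub is closed; rung R3 — NOT d = 4, NOT infinite volume, NOT a mass gap, NOT Clay; the Yang–Mills mass gap is NOT proved.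
-/

set_option autoImplicit false

noncomputable section

open scoped Matrix.Norms.L2Operator
open Finset

namespace Summit.QuantumFields.YangMills.Theorems.FluctuationComparisonRegPrIntLS2BetaCurlBudgetThm2Letters

open Literature.MathematicalPhysics.QuantumFieldTheory.Balaban1983to89
open Literature.MathematicalPhysics.QuantumFieldTheory.Balaban1983to89.T4Continuum
open Literature.MathematicalPhysics.QuantumFieldTheory.Balaban1983to89.T3ContinuumYM3Torus
open Literature.MathematicalPhysics.QuantumFieldTheory.Balaban1983to89.T3LevelShift
open Literature.MathematicalPhysics.QuantumFieldTheory.Balaban1983to89.T3TiltDescent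
open Literature.MathematicalPhysics.QuantumFieldTheory.Balaban1983to89.T3UnitLawDensityEML (ℰp)
open Literature.MathematicalPhysics.QuantumFieldTheory.Balaban1983to89.T4HaarSU2ExpChart (expPoint)
open Literature.MathematicalPhysics.QuantumFieldTheory.Balaban1983to89.T4ExpWindowSmallField (logVec)
open Literature.MathematicalPhysics.QuantumFieldTheory.Balaban1983to89.HaarExponentialChart
open Literature.MathematicalPhysics.QuantumFieldTheory.Balaban1983to89.HaarExponentialChart.IsChartRep
open Literature.MathematicalPhysics.QuantumFieldTheory.Balaban1983to89.BlockAveraging (Idx blockAvg avgFun loopHol)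
open Literature.MathematicalPhysics.QuantumFieldTheory.Balaban1983to89.ExpMeanLog (expMeanLogSU deltaSU)
open Literature.MathematicalPhysics.QuantumFieldTheory.Balaban1983to89.BlockAveragingEMLLinearisedBackground (covWalkSum)
open Literature.MathematicalPhysics.QuantumFieldTheory.Balaban1983to89.B10Eq47AxialChi (shiftN)
open Literature.MathematicalPhysics.QuantumFieldTheory.Balaban1983to89.B14.Eq22Determines (blockIter)
open Literature.MathematicalPhysics.QuantumFieldTheory.Balaban1983to89.B10Eq27TorusAxialLog (rel)
open Literature.MathematicalPhysics.QuantumFieldTheory.Balaban1983to89.B10Eq18SigmaSU2 (su2Coord)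
open Literature.MathematicalPhysics.QuantumFieldTheory.Balaban1983to89.B10Eq18SigmaSU2Haar (rev)
open Literature.MathematicalPhysics.QuantumLattice (su2Quat)
open Summit.QuantumFields.YangMills.Theorems.FluctuationComparisonRegPrIntLS2BetaChartReadDescentOntoExpPoint (su2Coord_rev_mem_lie)
open Summit.QuantumFields.YangMills.Theorems.FluctuationComparisonRegPrIntLS2BetaCurlBudgetBkgRegRep (c1Budget_bkgRegRep)
open Literature.MathematicalPhysics.QuantumFieldTheory.Balaban1983to89.B10Eq47AxialChi (rowProd)
open Summit.QuantumFields.YangMills.Theorems.FluctuationComparisonRegPrIntLS2BetaChartReadGaugeCovariance (conj_mem_lie)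
open Summit.QuantumFields.YangMills.Theorems.FluctuationComparisonRegPrIntLS2BetaSourceClassesOfBkg (plaqSmall_iter_of_bkg dist1_loopHol_iter_le_of_bkg bkgClass_nonneg bkgClass_lt_two_mul bkgClass_le_base)
open Literature.MathematicalPhysics.QuantumFieldTheory.Balaban1983to89.ExpMeanLog (deltaSU_pos)

variable (F : T3Family)

/-- ★ **THE TRANSPORTED SIZE FROM THE FINE SIZE** — `Λ̄·L^k·‖X 0‖ ≤ Λ̄·cX` for `k < K − J` from `‖X 0 b‖ ≤ cX·(L⁻¹)^(K−J)` (pi-norm, `Submodule.norm_coe`,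
`L^k·(L⁻¹)^(K−J) ≤ 1`). [cite: Balaban1985RegularSpaces, Thm 2 (1.36) p.82] -/
theorem transportedSize_of_fineSize {J K : ℕ} (X : (i : ℕ) → PBond (F.P K) i → (specialUnitaryLogChart (Fin 2)).lie) (C_B α : ℝ)
    (cX : ℝ) (hcX : 0 ≤ cX)
    (hX0 : ∀ b : PBond (F.P K) 0, ‖(((X 0) b : (specialUnitaryLogChart (Fin 2)).lie) : Matrix (Fin 2) (Fin 2) ℂ)‖ ≤ cX * ((((F.P K).L : ℝ))⁻¹ ^ (K - J))) :
    ∀ k, k < K - J → ((1 + 4 * (((F.P K).d + 2 : ℕ) : ℝ)) * Real.exp ((((F.P K).d + 2 : ℕ) : ℝ) * (422 + 1616 * (((F.P K).d + 2 : ℕ) : ℝ)) * (((((((F.P K).d + 2) * (F.P K).L : ℕ) : ℝ) ^ 2 / 4) * ((C_B + 1) * α)) / (((F.P K).L : ℝ) ^ 2 - 1)))) * ((F.P K).L : ℝ) ^ k * ‖X 0‖ ≤ (((1 + 4 * (((F.P K).d + 2 : ℕ) : ℝ)) * Real.exp ((((F.P K).d + 2 : ℕ) : ℝ) * (422 + 1616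 * (((F.P K).d + 2 : ℕ) : ℝ)) * (((((((F.P K).d + 2) * (F.P K).L : ℕ) : ℝ) ^ 2 / 4) * ((C_B + 1) * α)) / (((F.P K).L : ℝ) ^ 2 - 1)))) * cX) := by
  have hL2 : (2 : ℝ) ≤ (F.L : ℝ) := by exact_mod_cast F.hL.2
  have hL1' : (1 : ℝ) ≤ ((F.P K).L : ℝ) := by show (1 : ℝ) ≤ (F.L : ℝ); exact one_le_two.trans hL2
  have hPL0 : (0 : ℝ) < ((F.P K).L : ℝ) := zero_lt_one.trans_le hL1'
  have hη0 : (0 : ℝ) ≤ ((((F.P K).L : ℝ))⁻¹ ^ (K - J)) := pow_nonneg (inv_nonneg.2 hPL0.le) _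
  have hX0' : ‖X 0‖ ≤ cX * ((((F.P K).L : ℝ))⁻¹ ^ (K - J)) :=
    (pi_norm_le_iff_of_nonneg (mul_nonneg hcX hη0)).2 fun b => by rw [← Submodule.norm_coe]; exact hX0 b
  intro k hk
  have hθ : ((F.P K).L : ℝ) ^ k * ((((F.P K).L : ℝ))⁻¹ ^ (K - J)) ≤ 1 := by
    rw [inv_pow, ← div_eq_mul_inv, div_le_one (pow_pos hPL0 _)]
    exact pow_le_pow_right₀ hL1' (by omega)
  have hΛ : (0 : ℝ) ≤ ((1 + 4 * (((F.P K).d + 2 : ℕ) : ℝ)) * Real.exp ((((F.P K).d + 2 : ℕ) : ℝ) * (422 + 1616 * (((F.P K).d + 2 : ℕ) : ℝ)) * (((((((F.P K).d + 2) * (F.P K).L : ℕ) : ℝ) ^ 2 / 4) * ((C_B + 1) * α)) / (((F.P K).L : ℝ) ^ 2 - 1)))) := by positivity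
  calc ((1 + 4 * (((F.P K).d + 2 : ℕ) : ℝ)) * Real.exp ((((F.P K).d + 2 : ℕ) : ℝ) * (422 + 1616 * (((F.P K).d + 2 : ℕ) : ℝ)) * (((((((F.P K).d + 2) * (F.P K).L : ℕ) : ℝ) ^ 2 / 4) * ((C_B + 1) * α)) / (((F.P K).L : ℝ) ^ 2 - 1)))) * ((F.P K).L : ℝ) ^ k * ‖X 0‖
      ≤ ((1 + 4 * (((F.P K).d + 2 : ℕ) : ℝ)) * Real.exp ((((F.P K).d + 2 : ℕ) : ℝ) * (422 + 1616 * (((F.P K).d + 2 : ℕ) : ℝ)) * (((((((F.P K).d + 2) * (F.P K).L : ℕ) : ℝ) ^ 2 / 4) * ((C_B + 1) * α)) / (((F.P K).L : ℝ) ^ 2 - 1)))) * ((F.P K).L : ℝ) ^ k * (cX * ((((F.P K).L : ℝ))⁻¹ ^ (K - J))) := mul_le_mul_of_nonneg_left hX0' (by positivity)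
    _ = ((1 + 4 * (((F.P K).d + 2 : ℕ) : ℝ)) * Real.exp ((((F.P K).d + 2 : ℕ) : ℝ) * (422 + 1616 * (((F.P K).d + 2 : ℕ) : ℝ)) * (((((((F.P K).d + 2) * (F.P K).L : ℕ) : ℝ) ^ 2 / 4) * ((C_B + 1) * α)) / (((F.P K).L : ℝ) ^ 2 - 1)))) * cX * (((F.P K).L : ℝ) ^ k * ((((F.P K).L : ℝ))⁻¹ ^ (K - J))) := by ring
    _ ≤ ((1 + 4 * (((F.P K).d + 2 : ℕ) : ℝ)) * Real.exp ((((F.P K).d + 2 : ℕ) : ℝ) * (422 + 1616 * (((F.P K).d + 2 : ℕ) : ℝ)) * (((((((F.P K).d + 2) * (F.P K).L : ℕ) : ℝ) ^ 2 / 4) * ((C_B + 1) * α)) / (((F.P K).L : ℝ) ^ 2 - 1)))) * cX := mul_le_of_le_one_right (mul_nonneg hΛ hcX) hθ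

/-- ★★★ **THE c₁ LETTER OVER (BKG) + THM-2 LETTERS** — ✓`c1Budget_bkgRegRep` with `mT := Λ̄·cX`; see the module header.
[cite: Balaban1985Averaging, Prop. 3 (123), Prop. 4 (128)-(135) pp.37-38; Balaban1985RegularSpaces, Thm 2 (1.36) p.82; Balaban1987RG1, (0.11), (0.18) pp.253-255] -/
theorem c1Budget_thm2Letters {J K : ℕ} (hJK : J ≤ K) (Cst : ℝ) (hCst : 0 ≤ Cst)
    (U₀ : GaugeField (F.P K) 0 (Matrix.specialUnitaryGroup (Fin 2) ℂ)) (ζ : PBond (F.P K) 0 → EuclideanSpace ℝ (Fin 3))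
    (X : (i : ℕ) → PBond (F.P K) i → (specialUnitaryLogChart (Fin 2)).lie)
    (hXdef : X = fun (i : ℕ) (b : PBond (F.P K) i) =>
      (⟨su2Coord (rev (logVec (su2Quat (Averaging.iter (fun k => BlockAveraging.blockAvg (P := F.P K) (j := k) ℰp) i (fun ℓ => expPoint (ζ ℓ) * U₀ ℓ : GaugeField (F.P K) 0 (Matrix.specialUnitaryGroup (Fin 2) ℂ)) b * (Averaging.iter (fun k => BlockAveraging.blockAvg (P := F.P K) (j := k) ℰp) i U₀ b)⁻¹)))), su2Coord_rev_mem_lie _⟩ : (specialUnitaryLogChart (Fin 2)).lie))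
    (Mg : ℕ → ℝ) (hMg : ∀ t, t ≤ K - J → ∀ b : PBond (F.P K) t,
      ‖logVec (su2Quat (Averaging.iter (fun k => BlockAveraging.blockAvg (P := F.P K) (j := k) ℰp) t (fun ℓ => expPoint (ζ ℓ) * U₀ ℓ : GaugeField (F.P K) 0 (Matrix.specialUnitaryGroup (Fin 2) ℂ)) b * (Averaging.iter (fun k => BlockAveraging.blockAvg (P := F.P K) (j := k) ℰp) t U₀ b)⁻¹))‖ ≤ Mg t)
    (hMg4 : ∀ t, t ≤ K - J → Mg t ≤ 1 / 4)
    (C_B α : ℝ) (hCB : 0 ≤ C_B) (hα : 0 < α)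
    (hBKG : ∀ t, t ≤ K - J → ∀ p : Plaq (F.P K) t,
      dist1 (GaugeField.plaqHol (Averaging.iter (fun k => BlockAveraging.blockAvg (P := F.P K) (j := k) ℰp) t U₀) p) ≤
        C_B * α * (F.L : ℝ) ^ (2 * t) * ((F.L : ℝ)⁻¹) ^ (2 * (K - J)))
    (h24 : ((((F.P K).d + 2) * (F.P K).L : ℕ) : ℝ) ^ 2 / 4 * ((C_B + 1) * α) ≤ 1 / 24)
    (hSU : ((((F.P K).d + 2) * (F.P K).L : ℕ) : ℝ) ^ 2 / 4 * ((C_B + 1) * α) < deltaSU (Fin 2))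
    {ρr : ℝ} (hρ0 : 0 < ρr) (hρr : ρr ≤ innerRadius (specialUnitaryLogChart (Fin 2)))
    {a₀ : ℝ} (ha0 : 0 < a₀) (ha : 100 * (((((F.P K).d + 2) * (F.P K).L : ℕ) : ℝ) * (Real.exp a₀ - 1)) ≤ ρr)
    (r c₀ : ℕ → ℝ)
    (hwinK : 100 * (((((F.P K).d + 2) * (F.P K).L : ℕ) : ℝ) * (2 * ((((F.P K).d - 1 : ℕ) : ℝ) * ((2 * (F.P K).L : ℕ) : ℝ)) * (2 * ((C_B + 1) * α)) + (2 * (2 * ((((((F.P K).d + 2) * (F.P K).L : ℕ) : ℝ) ^ 2 / 4) * ((C_B + 1) * α)) / (((F.P K).L : ℝ) ^ 2 - ((F.P K).L : ℝ))) + (2 * ((C_B + 1) * α))))) ≤ ρr)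
    (hc₀nn : ∀ k, 0 ≤ (F.L : ℝ) ^ k * c₀ k)
    (hc₀ : ∀ k, k < K - J → ∀ (μ : Fin (F.P K).d) (b : PBond (F.P K) 0), ‖(((fun b : PBond (F.P K) 0 => (⟨((rowProd U₀ b.src μ ((F.P K).L ^ k) : Matrix.specialUnitaryGroup (Fin 2) ℂ) : Matrix (Fin 2) (Fin 2) ℂ) * (((X 0) (b.translate (Site.scaleTo k ((0 : Site (F.P K) k).shift μ))) : (specialUnitaryLogChart (Fin 2)).lie) : Matrix (Fin 2) (Fin 2) ℂ) * star ((rowProd U₀ b.src μ ((F.P K).L ^ k) : Matrix.specialUnitaryGroup (Fin 2) ℂ) : Matrix (Fin 2) (Fin 2) ℂ), conj_mem_lie (rowProd U₀ b.src μ ((F.P K).L ^ k)) ((X 0) (b.translate (Site.scaleTo k ((0 : Site (F.P K) k).shift μ))))⟩ : (specialUnitaryLogChart (Fin 2)).lie)) b : (specialUnitaryLogChart (Fin 2)).lie) : Matrix (Fin 2) (Fin 2) ℂ) - (((X 0) b : (specialUnitaryLogChart (Fin 2)).lie) : Matrix (Fin 2) (Fin 2) ℂ)‖ ≤ (F.L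 : ℝ) ^ k * c₀ k)
    (hr0 : ∀ l, 0 ≤ r l)
    (hr : ∀ i, i < K - J → ∀ c' : PBond (F.P K) (i + 1),
      ‖((X (i + 1) c' : (specialUnitaryLogChart (Fin 2)).lie) : Matrix (Fin 2) (Fin 2) ℂ) - (((fderiv ℝ (fun (B : PBond (F.P K) i → (specialUnitaryLogChart (Fin 2)).lie) (c' : PBond (F.P K) (i + 1)) => (isChartRep_specialUnitaryGroup (n := Fin 2)).logChart (avgFun (expMeanLogSU (n := Fin 2)) (fun c => (isChartRep_specialUnitaryGroup (n := Fin 2)).expChart (B c) * (Averaging.iter (fun i => blockAvg (P := F.P K) (j := i) (expMeanLogSU (n := Fin 2))) i U₀) c) c' * (avgFun (expMeanLogSU (n := Fin 2)) ((Averaging.iter (fun i => blockAvg (P := F.P K) (j := i) (expMeanLogSU (n := Fin 2))) i U₀)) c')⁻¹)) 0) (X i) c' : (specialUnitaryLogChart (Fin 2)).lie) : Matrix (Fin 2) (Fin 2) ℂ)‖ ≤ r (i + 1))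
    (Cr Cc : ℝ) (hCr : 0 ≤ Cr) (hCc : 0 ≤ Cc)
    (hrp : ∀ i, i < K - J → r (i + 1) ≤ Cr * ((F.P K).L : ℝ) ^ (2 * i) * ((F.L : ℝ) ^ (2 * (K - J)))⁻¹)
    (cX : ℝ) (hcX : 0 ≤ cX)
    (hX0 : ∀ b : PBond (F.P K) 0, ‖(((X 0) b : (specialUnitaryLogChart (Fin 2)).lie) : Matrix (Fin 2) (Fin 2) ℂ)‖ ≤ cX * ((((F.P K).L : ℝ))⁻¹ ^ (K - J)))
    (ha16 : 16 * (((1 + 4 * (((F.P K).d + 2 : ℕ) : ℝ)) * Real.exp ((((F.P K).d + 2 : ℕ) : ℝ) * (422 + 1616 * (((F.P K).d + 2 : ℕ) : ℝ)) * (((((((F.P K).d + 2) * (F.P K).L : ℕ) : ℝ) ^ 2 / 4) * ((C_B + 1) * α)) / (((F.P K).L : ℝ) ^ 2 - 1)))) * (cX + Cr / (((F.P K).L : ℝ) - 1))) ≤ a₀)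
    (hcc : ∀ k, k < K - J → ((1 + 4 * (((F.P K).d + 2 : ℕ) : ℝ)) * Real.exp ((((F.P K).d + 2 : ℕ) : ℝ) * (422 + 1616 * (((F.P K).d + 2 : ℕ) : ℝ)) * (((((((F.P K).d + 2) * (F.P K).L : ℕ) : ℝ) ^ 2 / 4) * ((C_B + 1) * α)) / (((F.P K).L : ℝ) ^ 2 - 1)))) * ((F.P K).L : ℝ) ^ k * ((F.L : ℝ) ^ k * c₀ k) ≤ Cc * (((F.P K).L : ℝ) ^ (2 * k) * ((F.L : ℝ) ^ (2 * (K - J)))⁻¹))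
    (hρα : 4 * ((((((F.P K).d + 2) * (F.P K).L : ℕ) : ℝ) ^ 2 / 4) * (2 * ((C_B + 1) * α))) ≤ ρr)
    (hρδ : 100 * (((((F.P K).d + 2) * (F.P K).L : ℕ) : ℝ) * ((((F.P K).d - 1 : ℕ) : ℝ) * ((3 * (F.P K).L : ℕ) : ℝ) * (2 * ((C_B + 1) * α)))) ≤ ρr)
    (c : ℝ) (hc0 : 0 ≤ c) (hc4 : 4 * c ≤ 1)
    (hζc : ∀ ℓ : PBond (F.P K) 0, ‖ζ ℓ‖ ≤ c * ((F.L : ℝ)⁻¹) ^ (K - J))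
    (Mbar : ℝ) (hM0 : 0 ≤ Mbar) (hM1 : 4 * Mbar ≤ 1)
    (hM : ∀ s, s < K - J → ∀ b : PBond (F.P K) s, ‖logVec (su2Quat (Averaging.iter (fun k => BlockAveraging.blockAvg (P := F.P K) (j := k) ℰp) s (fun ℓ => expPoint (ζ ℓ) * U₀ ℓ : GaugeField (F.P K) 0 (Matrix.specialUnitaryGroup (Fin 2) ℂ)) b * (Averaging.iter (fun k => BlockAveraging.blockAvg (P := F.P K) (j := k) ℰp) s U₀ b)⁻¹))‖ ≤ Mbar) :
    ∑ t ∈ Finset.range (K - J), (F.L : ℝ) ^ t * (fun t => Cst * ∑ B : PBond (F.P J) 0,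
      ‖(fun p : Plaq (F.P K) (K - J - 1 - t) =>
        if ∃ z₀ : Site (F.P K) 0, (blockIter (K - J) z₀ = (bondShift (F.sitesPerDir_eq (m := F.m) (K := J) (j := 0) (m' := F.m) (K' := K) (j' := K - J) (by omega)) B).src ∨
            blockIter (K - J) z₀ = (bondShift (F.sitesPerDir_eq (m := F.m) (K := J) (j := 0) (m' := F.m) (K' := K) (j' := K - J) (by omega)) B).tgt) ∧
            ∀ κ, (rel (blockIter (K - J - 1 - t) z₀) p.src κ).natAbs ≤ (2 * F.L + 1)
        then dist1 ((GaugeField.plaqHol (Averaging.iter (fun k => BlockAveraging.blockAvg (P := F.P K) (j := k) ℰp) (K - J - 1 - t) U₀) p)⁻¹ *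
          GaugeField.plaqHol (Averaging.iter (fun k => BlockAveraging.blockAvg (P := F.P K) (j := k) ℰp) (K - J - 1 - t)
            (fun ℓ => expPoint (ζ ℓ) * U₀ ℓ : GaugeField (F.P K) 0 (Matrix.specialUnitaryGroup (Fin 2) ℂ))) p)
        else 0)‖ ^ 2) t ≤
      2 * ((2 * Cst * (((5 ^ (F.P K).d : ℕ) : ℝ) ^ 2 * (((2 * ((2 * F.L + 1) + 2) + 1) ^ (F.P K).d * 6 : ℕ) : ℝ) *
              (2 * ((((F.P K).L ^ (F.P K).d : ℕ) : ℝ) - 1) / ((((F.P K).L ^ (F.P K).d : ℕ) : ℝ) - 3)))) * (4 * (F.L : ℝ)⁻¹ * ((F.L : ℝ) ^ (K - J) * ∑ p : Plaq (F.P K) 0,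
                  (1 - reTr ((GaugeField.plaqHol U₀ p)⁻¹ * GaugeField.plaqHol (fun ℓ => expPoint (ζ ℓ) * U₀ ℓ : GaugeField (F.P K) 0 (Matrix.specialUnitaryGroup (Fin 2) ℂ)) p))) + 7 *
      (12 * ((F.P K).d : ℝ) ^ 2 * (2 * ((F.P K).L : ℝ) ^ 2 * (3 * (F.P K).L + 2) + 2 * ((F.P K).L : ℝ) ^ 2 + (48 * (F.P K).L + 24 * ((((F.P K).d + 2) * (F.P K).L : ℕ) : ℝ) + 1616 * ((((F.P K).d + 2) * (F.P K).L : ℕ) : ℝ)) * (((((F.P K).d + 2) * (F.P K).L : ℕ) : ℝ) ^ 2 / 4) +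
        2 * ((((F.P K).d + 2) * (F.P K).L : ℕ) : ℝ) * ((F.L : ℝ) ^ 2)) ^ 2 * (2 * ((C_B + 1) * α)) ^ 2 *
        (∑ t ∈ Finset.range (K - J), (if ht : t < K - J then
          (F.L : ℝ) ^ t * ∑ B : PBond (F.P J) 0,
            ‖(fun ℓ' : PBond (F.P (J + (t + 1))) 0 =>
              if ∃ z : Site (F.P (J + (t + 1))) 0,
                (B14.Eq22Determines.blockIter (t + 1) z = (bondShift (F.sitesPerDir_eq (m := F.m) (K := J) (j := 0) (m' := F.m) (K' := J + (t + 1)) (j' := t + 1) (by omega)) B).src ∨ B14.Eq22Determines.blockIter (t + 1) z = (bondShift (F.sitesPerDir_eq (m := F.m) (K := J) (j := 0) (m' := F.m) (K' := J + (t + 1)) (j' := t + 1) (by omega)) B).tgt) ∧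
                ∀ ν, (B10Eq27TorusAxialLog.rel z ℓ'.src ν).natAbs ≤ 2
              then logVec (su2Quat (descendTo F ℰp (J + (t + 1)) K (by omega) (fun ℓ => expPoint (ζ ℓ) * U₀ ℓ : GaugeField (F.P K) 0 (Matrix.specialUnitaryGroup (Fin 2) ℂ)) ℓ' * (descendTo F ℰp (J + (t + 1)) K (by omega) U₀ ℓ')⁻¹)) else 0)‖ ^ 2
        else 0)) / (F.L : ℝ) +
      (192 * ((F.P K).d : ℝ) ^ 2 *
        (16 * (54 * (((((F.P K).d + 2) * (F.P K).L : ℕ) : ℝ) * (Real.exp a₀ - 1))) * (2 * ((((F.P K).d : ℕ) : ℝ) * ((3 * (F.P K).L : ℕ) : ℝ)) * (2 * (2 * ((((((F.P K).d + 2) * (F.P K).L : ℕ) : ℝ) ^ 2 / 4) * ((C_B + 1) * α)) / (((F.P K).L : ℝ) ^ 2 - ((F.P K).L : ℝ))) * (((1 + 4 * (((F.P K).d + 2 : ℕ) : ℝ)) * Real.exp ((((F.P K).d + 2 : ℕ) : ℝ) * (422 + 1616 * (((F.P K).d + 2 : ℕ) : ℝ)) * (((((((F.P K).d + 2) * (F.P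 K).L : ℕ) : ℝ) ^ 2 / 4) * ((C_B + 1) * α)) / (((F.P K).L : ℝ) ^ 2 - 1)))) * cX) + (((1 + 4 * (((F.P K).d + 2 : ℕ) : ℝ)) * Real.exp ((((F.P K).d + 2 : ℕ) : ℝ) * (422 + 1616 * (((F.P K).d + 2 : ℕ) : ℝ)) * (((((((F.P K).d + 2) * (F.P K).L : ℕ) : ℝ) ^ 2 / 4) * ((C_B + 1) * α)) / (((F.P K).L : ℝ) ^ 2 - 1)))) * cX) * (((1 + 4 * (((F.P K).d + 2 : ℕ) : ℝ)) * Real.exp ((((F.P K).d + 2 : ℕ) : ℝ) * (422 + 1616 * (((F.P K).d + 2 : ℕ) : ℝ)) * (((((((F.P K).d + 2) * (F.P K).L : ℕ) : ℝ) ^ 2 / 4) * ((C_B + 1) * α)) / (((F.P K).L : ℝ) ^ 2 - 1)))) / ((F.P K).L : ℝ)) * ((2 * 67 * ((((F.P K).d + 2) * (F.P K).L : ℕ) : ℝ) / a₀) * (2 * ((((F.P K).d - 1 : ℕ) : ℝ) * ((2 * (F.P K).L : ℕ) : ℝ)) * (2 * ((C_B + 1) * α)) / (((F.P K).L : ℝ)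 ^ 2 - 1) + (2 * (2 * ((((((F.P K).d + 2) * (F.P K).L : ℕ) : ℝ) ^ 2 / 4) * ((C_B + 1) * α)) / (((F.P K).L : ℝ) ^ 2 - ((F.P K).L : ℝ))) + (2 * ((C_B + 1) * α))) / (((F.P K).L : ℝ) - 1))) + Cc + 2 * (((1 + 4 * (((F.P K).d + 2 : ℕ) : ℝ)) * Real.exp ((((F.P K).d + 2 : ℕ) : ℝ) * (422 + 1616 * (((F.P K).d + 2 : ℕ) : ℝ)) * (((((((F.P K).d + 2) * (F.P K).L : ℕ) : ℝ) ^ 2 / 4) * ((C_B + 1) * α)) / (((F.P K).L : ℝ) ^ 2 - 1)))) * Cr / (((F.P K).L : ℝ) ^ 2 - ((F.P K).L : ℝ))))) / (15 * a₀ / 16) ^ 2 + 32 * (54 * (((((F.P K).d + 2) * (F.P K).L : ℕ) : ℝ) * (Real.exp a₀ - 1))) * (2 * ((((F.P K).d : ℕ) : ℝ) * ((3 * (F.P K).L : ℕ) : ℝ)) * (2 * (2 * ((((((F.P K).d + 2) * (F.P K).L : ℕ) : ℝ) ^ 2 / 4) * ((C_B + 1) * α)) / (((F.P K).L : ℝ)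 ^ 2 - ((F.P K).L : ℝ))) * (((1 + 4 * (((F.P K).d + 2 : ℕ) : ℝ)) * Real.exp ((((F.P K).d + 2 : ℕ) : ℝ) * (422 + 1616 * (((F.P K).d + 2 : ℕ) : ℝ)) * (((((((F.P K).d + 2) * (F.P K).L : ℕ) : ℝ) ^ 2 / 4) * ((C_B + 1) * α)) / (((F.P K).L : ℝ) ^ 2 - 1)))) * cX) + (((1 + 4 * (((F.P K).d + 2 : ℕ) : ℝ)) * Real.exp ((((F.P K).d + 2 : ℕ) : ℝ) * (422 + 1616 * (((F.P K).d + 2 : ℕ) : ℝ)) * (((((((F.P K).d + 2) * (F.P K).L : ℕ) : ℝ) ^ 2 / 4) * ((C_B + 1) * α)) / (((F.P K).L : ℝ) ^ 2 - 1)))) * cX) * (((1 + 4 * (((F.P K).d + 2 : ℕ) : ℝ)) * Real.exp ((((F.P K).d + 2 : ℕ) : ℝ) * (422 + 1616 * (((F.P K).d + 2 : ℕ) : ℝ)) * (((((((F.P K).d + 2) * (F.P K).L : ℕ) : ℝ) ^ 2 / 4) * ((C_B + 1) * α)) / (((F.P K).L : ℝ) ^ 2 - 1)))) / ((F.P K).L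 : ℝ)) * ((2 * 67 * ((((F.P K).d + 2) * (F.P K).L : ℕ) : ℝ) / a₀) * (2 * ((((F.P K).d - 1 : ℕ) : ℝ) * ((2 * (F.P K).L : ℕ) : ℝ)) * (2 * ((C_B + 1) * α)) / (((F.P K).L : ℝ) ^ 2 - 1) + (2 * (2 * ((((((F.P K).d + 2) * (F.P K).L : ℕ) : ℝ) ^ 2 / 4) * ((C_B + 1) * α)) / (((F.P K).L : ℝ) ^ 2 - ((F.P K).L : ℝ))) + (2 * ((C_B + 1) * α))) / (((F.P K).L : ℝ) - 1))) + Cc + 2 * (((1 + 4 * (((F.P K).d + 2 : ℕ) : ℝ)) * Real.exp ((((F.P K).d + 2 : ℕ) : ℝ) * (422 + 1616 * (((F.P K).d + 2 : ℕ) : ℝ)) * (((((((F.P K).d + 2) * (F.P K).L : ℕ) : ℝ) ^ 2 / 4) * ((C_B + 1) * α)) / (((F.P K).L : ℝ) ^ 2 - 1)))) * Cr / (((F.P K).L : ℝ) ^ 2 - ((F.P K).L : ℝ))))) / a₀ ^ 2 +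
          ((((F.P K).d + 2) * (F.P K).L : ℕ) : ℝ) ^ 3 * (((1 + 4 * (((F.P K).d + 2 : ℕ) : ℝ)) * Real.exp ((((F.P K).d + 2 : ℕ) : ℝ) * (422 + 1616 * (((F.P K).d + 2 : ℕ) : ℝ)) * (((((((F.P K).d + 2) * (F.P K).L : ℕ) : ℝ) ^ 2 / 4) * ((C_B + 1) * α)) / (((F.P K).L : ℝ) ^ 2 - 1)))) * (cX + Cr / (((F.P K).L : ℝ) - 1))) ^ 2 + 8 * (67 * (((((F.P K).d + 2) * (F.P K).L : ℕ) : ℝ) * ((((F.P K).d - 1 : ℕ) : ℝ) * ((3 * (F.P K).L : ℕ) : ℝ) * (2 * ((C_B + 1) * α))))) * (((1 + 4 * (((F.P K).d + 2 : ℕ) : ℝ)) * Real.exp ((((F.P K).d + 2 : ℕ) : ℝ) * (422 + 1616 * (((F.P K).d + 2 : ℕ) : ℝ)) * (((((((F.P K).d + 2) * (F.P K).L : ℕ) : ℝ) ^ 2 / 4) * ((C_B + 1) * α)) / (((F.P K).L : ℝ) ^ 2 - 1)))) * (cX + Cr / (((F.P K).L : ℝ) - 1))) / a₀ ^ 2)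 ^ 2 *
        (∑ t ∈ Finset.range (K - J), (if ht : t < K - J then
          (F.L : ℝ) ^ t * ∑ B : PBond (F.P J) 0,
            ‖(fun ℓ' : PBond (F.P (J + (t + 1))) 0 =>
              if ∃ z : Site (F.P (J + (t + 1))) 0,
                (B14.Eq22Determines.blockIter (t + 1) z = (bondShift (F.sitesPerDir_eq (m := F.m) (K := J) (j := 0) (m' := F.m) (K' := J + (t + 1)) (j' := t + 1) (by omega)) B).src ∨ B14.Eq22Determines.blockIter (t + 1) z = (bondShift (F.sitesPerDir_eq (m := F.m) (K := J) (j := 0) (m' := F.m) (K' := J + (t + 1)) (j' := t + 1) (by omega)) B).tgt) ∧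
                ∀ ν, (B10Eq27TorusAxialLog.rel z ℓ'.src ν).natAbs ≤ 2
              then logVec (su2Quat (descendTo F ℰp (J + (t + 1)) K (by omega) (fun ℓ => expPoint (ζ ℓ) * U₀ ℓ : GaugeField (F.P K) 0 (Matrix.specialUnitaryGroup (Fin 2) ℂ)) ℓ' * (descendTo F ℰp (J + (t + 1)) K (by omega) U₀ ℓ')⁻¹)) else 0)‖ ^ 2
        else 0)) / (F.L : ℝ)) +
      3 * ((768 * c ^ 2 * (F.L : ℝ)) *
        (((F.L : ℝ)⁻¹) ^ (K - J) * ∑ ℓ : PBond (F.P K) 0, ‖ζ ℓ‖ ^ 2 +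
          (F.L : ℝ) ^ (K - J) * ∑ p : Plaq (F.P K) 0,
            (1 - reTr ((GaugeField.plaqHol U₀ p)⁻¹ * GaugeField.plaqHol (fun ℓ => expPoint (ζ ℓ) * U₀ ℓ : GaugeField (F.P K) 0 (Matrix.specialUnitaryGroup (Fin 2) ℂ)) p))))))) +
      2 * ((256 * Cst * Mbar ^ 2 * ((2 * (F.P J).d * (2 * 3 + 1) ^ (F.P J).d : ℕ) : ℝ)) * (∑ t ∈ Finset.range (K - J), (if ht : t < K - J then
          (F.L : ℝ) ^ t * ∑ B : PBond (F.P J) 0,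
            ‖(fun ℓ' : PBond (F.P (J + (t + 1))) 0 =>
              if ∃ z : Site (F.P (J + (t + 1))) 0,
                (B14.Eq22Determines.blockIter (t + 1) z = (bondShift (F.sitesPerDir_eq (m := F.m) (K := J) (j := 0) (m' := F.m) (K' := J + (t + 1)) (j' := t + 1) (by omega)) B).src ∨ B14.Eq22Determines.blockIter (t + 1) z = (bondShift (F.sitesPerDir_eq (m := F.m) (K := J) (j := 0) (m' := F.m) (K' := J + (t + 1)) (j' := t + 1) (by omega)) B).tgt) ∧
                ∀ ν, (B10Eq27TorusAxialLog.rel z ℓ'.src ν).natAbs ≤ 2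
              then logVec (su2Quat (descendTo F ℰp (J + (t + 1)) K (by omega) (fun ℓ => expPoint (ζ ℓ) * U₀ ℓ : GaugeField (F.P K) 0 (Matrix.specialUnitaryGroup (Fin 2) ℂ)) ℓ' * (descendTo F ℰp (J + (t + 1)) K (by omega) U₀ ℓ')⁻¹)) else 0)‖ ^ 2
        else 0))) := by
  have hmT : (0 : ℝ) ≤ (((1 + 4 * (((F.P K).d + 2 : ℕ) : ℝ)) * Real.exp ((((F.P K).d + 2 : ℕ) : ℝ) * (422 + 1616 * (((F.P K).d + 2 : ℕ) : ℝ)) * (((((((F.P K).d + 2) * (F.P K).L : ℕ) : ℝ) ^ 2 / 4) * ((C_B + 1) * α)) / (((F.P K).L : ℝ) ^ 2 - 1)))) * cX) := mul_nonneg (by positivity) hcX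
  have hMT := transportedSize_of_fineSize F X C_B α cX hcX hX0
  exact c1Budget_bkgRegRep F hJK Cst hCst U₀ ζ X hXdef Mg hMg hMg4 C_B α hCB hα hBKG h24 hSU hρ0 hρr ha0 ha
    r c₀ hwinK hc₀nn hc₀ hr0 hr Cr Cc (((1 + 4 * (((F.P K).d + 2 : ℕ) : ℝ)) * Real.exp ((((F.P K).d + 2 : ℕ) : ℝ) * (422 + 1616 * (((F.P K).d + 2 : ℕ) : ℝ)) * (((((((F.P K).d + 2) * (F.P K).L : ℕ) : ℝ) ^ 2 / 4) * ((C_B + 1) * α)) / (((F.P K).L : ℝ) ^ 2 - 1)))) * cX) hCr hCc hmT hrp cX hcX hX0 ha16 hMT hcc hρα hρδ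
    c hc0 hc4 hζc Mbar hM0 hM1 hM

end Summit.QuantumFields.YangMills.Theorems.FluctuationComparisonRegPrIntLS2BetaCurlBudgetThm2Letters

end
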